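import Mathlib
import Summits.ValiantsHypothesis.ValiantsHypothesis.Theorems.FifoMatchingNNDivisionHardFewSummandsUnion
import Summits.ValiantsHypothesis.ValiantsHypothesis.Theorems.FifoMatchingNNDivisionHardFewSummandsProducts
import HarnessLib

/-!
# The transport of UNIONS OF PRODUCT FAMILIES and the few-summands law for unions READ ON `NN_n` — part 1 of the `ΣΠ`-sparse tier
# (crux `Theses.FifoMatching.NNDivisionHard`, stmt-ValiantsHypothesis-21181)

WHAT IS NEW.  ✓ `…FewSummandsProducts.nnDivisionHard_prod_sparseFactors` decides ONE product of polynomially many sparse factors.  Over `ℝ≥0`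
the support of a SUM is the UNION of the supports, so `Newt(Σ_k Π_i p_{k,i}) = conv(⋃_k Σ_i Newt p_{k,i})` — a UNION of Minkowski sums, the
shape decided at the COR level by ✓ `…FewSummandsUnion.union_summands_decided` (one-cut rung with a label count).  This file carries the
union-of-product-families shape through the located-face transport and reads the law on `NN_n`:

* `unionFamily_face`, `transport_step_union`, ★ `transport_geometric_union`, ★★ `nn_union_fewSummands` (explicit form) — PART 1 (this file);
* PART 2 (sibling `…FewSummandsSumsOfProducts`): ★★★ `nnDivisionHard_unionSummands`, ★★★ `nnDivisionHard_sum_prod_sparseFactors` — for all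
  `c k`, eventually in `n`: every `hh = Σ_{j<K} Π_{i<M} p_{j,i}` over `ℝ≥0` with all `p_{j,i} ≠ 0`, `|supp p_{j,i}| ≤ m`, `K ≤ n^k`,
  `K·M·m² ≤ n^k` satisfies the crux's literal inequality — ANY degrees: depth-three `ΣΠΣ`-sparse cofactors of polynomial format.

HONEST FRAMING: a restriction theorem (a decided sub-class of cofactors), NOT the crux: stmt-21181 `NNDivisionHard` OPEN; COR-VIRTUAL OPEN;
`NNNotVP` OPEN; `VP ≠ VNP` NOT proved.  No definitions, no named facts, no sorry.  References: Hrubeš–Yehudayoff 2021 §6 Problem 2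
[HrubesYehudayoff2021]; Kaibel–Weltge 2015 [KaibelWeltge2014]; Fiorini et al. 2015 [FioriniEtAl2015]; AFHMS 2019 [AboulkerEtAl2019].
-/

set_option autoImplicit false

-- the mandated summit-side namespace repeats a component by design (single-problem summit)
set_option linter.dupNamespace false

noncomputable section

open Matrix Finset
open scoped Pointwise

namespace Summit.ValiantsHypothesis.ValiantsHypothesis.Theorems.FifoMatching

namespace Summands

open Literature.Barriers.PneNP (HasEFOfSize sum_dotProduct_le_sum_of_valid inter_eqs_eq_inter_sum_of_valid)
open Literature.Combinatorics.Optimization (corPolytopeGraph)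
open Summit.ValiantsHypothesis.ValiantsHypothesis.Theorems.FifoMatching.XcDivision
open Summit.ValiantsHypothesis.ValiantsHypothesis.Theorems.FifoMatching.LowDim (newt_inter_zeroSet_eq)
open MvPolynomial
open scoped NNReal
open Literature.Computability.AlgebraicComplexity (complexity nestFreeMatchingPoly)
open Literature.Computability.AlgebraicComplexity.MonotoneCircuitEF (hasEFOfSize_newtonPolytope_complexity)
open Literature.Algebra.Polynomial.NewtonPolytope (newtonPolytope newtonPolytope_mul)
open Summit.ValiantsHypothesis.ValiantsHypothesis.Theorems.FifoMatching.QueueGridFace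
  (realOf suppPts newt QGV patternVec queueGridPP corMap corMap_image_queueGridPP newt_nonneg)
open Summit.ValiantsHypothesis.ValiantsHypothesis.Theorems.FifoMatching.GridCorShadow (queueGridZeroOnePoints_holds)
open Summit.ValiantsHypothesis.ValiantsHypothesis.Theorems.FifoMatching.MonomialCofactor (newt_eq_newtonPolytope)
open Literature.Combinatorics.Optimization (AboulkerEtAl2019_gridCorCliqueFace)
open Summit.ValiantsHypothesis.ValiantsHypothesis.Theorems.FifoMatching.Zono (zone_params zones_threshold newtonPolytope_prod)
open Summit.ValiantsHypothesis.ValiantsHypothesis.Theorems.FifoMatching.FaceBlind (one_le_L)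

/-! ## §1 Faces and linear images of unions of product families -/

/-- the face of a UNION of product families in direction `φ` is again a union of product families of the same shape `(K, M, m)`
(labels not attaining the maximum are replaced by a maximal one; each summand is retracted onto its maximisers). [folklore] -/
theorem unionFamily_face {ι : Type} [Fintype ι] {K M m : ℕ} (hK : 1 ≤ K) (hm : 1 ≤ m)
    (vtx : Fin K → Fin M → Fin m → ι → ℝ) (w : Fin K → ι → ℝ) (φ : ι → ℝ) :
    ∃ (vtx' : Fin K → Fin M → Fin m → ι → ℝ) (w' : Fin K → ι → ℝ) (δ : ℝ),
      (∀ kf : Fin K × (Fin M → Fin m), φ ⬝ᵥ (w kf.1 + ∑ i, vtx kf.1 i (kf.2 i)) ≤ δ) ∧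
      {x | x ∈ Set.range (fun kf : Fin K × (Fin M → Fin m) => w kf.1 + ∑ i, vtx kf.1 i (kf.2 i)) ∧ φ ⬝ᵥ x = δ} =
        Set.range (fun kf : Fin K × (Fin M → Fin m) => w' kf.1 + ∑ i, vtx' kf.1 i (kf.2 i)) := by
  classical
  haveI : Nonempty (Fin M → Fin m) := ⟨fun _ => ⟨0, hm⟩⟩
  -- per label: the product face
  have hpf := fun k => prodFamily_face hm (vtx k) (w k) φ
  choose vk δk hlek hfacek using hpf
  -- `δk k` is attained (the face is a nonempty range)
  have hatt : ∀ k, ∃ f : Fin M → Fin m, φ ⬝ᵥ (w k + ∑ i, vtx k i (f i)) = δk k := by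
    intro k
    obtain ⟨f₀⟩ := (inferInstance : Nonempty (Fin M → Fin m))
    have hx : (w k + ∑ i, vk k i (f₀ i)) ∈ Set.range (fun f : Fin M → Fin m => w k + ∑ i, vk k i (f i)) := ⟨f₀, rfl⟩
    rw [← hfacek k] at hx
    obtain ⟨⟨f, hf⟩, hval⟩ := hx
    refine ⟨f, ?_⟩
    simp only at hf
    rw [hf]; exact hval
  -- the maximal label value
  haveI : Nonempty (Fin K) := ⟨⟨0, hK⟩⟩
  obtain ⟨k₀, -, hk₀⟩ := Finset.exists_max_image Finset.univ δk Finset.univ_nonempty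
  have hkle : ∀ k, δk k ≤ δk k₀ := fun k => hk₀ k (Finset.mem_univ k)
  let rk : Fin K → Fin K := fun k => if δk k = δk k₀ then k else k₀
  have hrk_max : ∀ k, δk (rk k) = δk k₀ := by
    intro k; by_cases hkk : δk k = δk k₀ <;> simp [rk, hkk]
  have hrk_id : ∀ k, δk k = δk k₀ → rk k = k := by intro k hkk; simp [rk, hkk]
  refine ⟨fun k => vk (rk k), fun k => w (rk k), δk k₀, ?_, ?_⟩
  · rintro ⟨k, f⟩
    exact (hlek k f).trans (hkle k)
  ext x
  simp only [Set.mem_setOf_eq, Set.mem_range]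
  constructor
  · rintro ⟨⟨⟨k, f⟩, rfl⟩, hx⟩
    have hkk : δk k = δk k₀ := le_antisymm (hkle k) (by rw [← hx]; exact hlek k f)
    have hmem : (w k + ∑ i, vtx k i (f i)) ∈
        {y | y ∈ Set.range (fun f : Fin M → Fin m => w k + ∑ i, vtx k i (f i)) ∧ φ ⬝ᵥ y = δk k} :=
      ⟨⟨f, rfl⟩, by rw [hkk]; exact hx⟩
    rw [hfacek k] at hmem
    obtain ⟨f', hf'⟩ := hmem
    refine ⟨(k, f'), ?_⟩
    simp only [hrk_id k hkk]
    exact hf'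
  · rintro ⟨⟨k, f⟩, rfl⟩
    have hmem : (w (rk k) + ∑ i, vk (rk k) i (f i)) ∈
        Set.range (fun f : Fin M → Fin m => w (rk k) + ∑ i, vk (rk k) i (f i)) := ⟨f, rfl⟩
    rw [← hfacek (rk k)] at hmem
    obtain ⟨⟨g, hg⟩, hval⟩ := hmem
    refine ⟨⟨(rk k, g), hg⟩, ?_⟩
    rw [hval, hrk_max k]

/-! ## §2 The transport WITH the shape `(K, M, m)` -/

/-- **ONE TRANSPORT STEP, with `(K, M, m)`** (as `transport_step_prod`, for unions of product families). [cite: FioriniEtAl2015, Lemma 9] -/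
theorem transport_step_union {ι κ : Type} [Fintype ι] [Fintype κ] {K M m : ℕ} (hK : 1 ≤ K) (hm : 1 ≤ m)
    {P : Set (ι → ℝ)} (vtx : Fin K → Fin M → Fin m → ι → ℝ) (w : Fin K → ι → ℝ) {r : ℕ}
    (h : HasEFOfSize (P + convexHull ℝ (Set.range fun kf : Fin K × (Fin M → Fin m) =>
      w kf.1 + ∑ i, vtx kf.1 i (kf.2 i))) r)
    (φ : ι → ℝ) (δ : ℝ) (hP : ∀ x ∈ P, φ ⬝ᵥ x ≤ δ) (L : (ι → ℝ) →ₗ[ℝ] (κ → ℝ)) :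
    ∃ (vtx' : Fin K → Fin M → Fin m → κ → ℝ) (w' : Fin K → κ → ℝ),
      HasEFOfSize (L '' (P ∩ {x | φ ⬝ᵥ x = δ}) +
        convexHull ℝ (Set.range fun kf : Fin K × (Fin M → Fin m) => w' kf.1 + ∑ i, vtx' kf.1 i (kf.2 i))) r := by
  classical
  obtain ⟨vtx₁, w₁, δQ, hle, hface⟩ := unionFamily_face hK hm vtx w φ
  have hQ : ∀ y ∈ convexHull ℝ (Set.range fun kf : Fin K × (Fin M → Fin m) => w kf.1 + ∑ i, vtx kf.1 i (kf.2 i)),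
      φ ⬝ᵥ y ≤ δQ :=
    dot_le_of_mem_convexHull _ φ _ (by rintro _ ⟨kf, rfl⟩; exact hle kf)
  have h2 := hasEFOfSize_image_add (h.face_add_face₁ φ δ δQ hP hQ) L
  rw [convexHull_range_inter_eq _ φ δQ hle, LinearMap.image_convexHull] at h2
  have hrange : Set.range (fun j : {kf : Fin K × (Fin M → Fin m) // φ ⬝ᵥ (w kf.1 + ∑ i, vtx kf.1 i (kf.2 i)) = δQ} =>
      w j.1.1 + ∑ i, vtx j.1.1 i (j.1.2 i)) =
      Set.range (fun kf : Fin K × (Fin M → Fin m) => w₁ kf.1 + ∑ i, vtx₁ kf.1 i (kf.2 i)) := by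
    rw [← hface]
    ext x
    simp only [Set.mem_range, Set.mem_setOf_eq]
    constructor
    · rintro ⟨⟨kf, hkf⟩, rfl⟩
      exact ⟨⟨kf, rfl⟩, hkf⟩
    · rintro ⟨⟨kf, rfl⟩, hx⟩
      exact ⟨⟨kf, hx⟩, rfl⟩
  rw [hrange, ← Set.range_comp] at h2
  refine ⟨fun k i b => L (vtx₁ k i b), fun k => L (w₁ k), ?_⟩
  have hcomp : (⇑L ∘ fun kf : Fin K × (Fin M → Fin m) => w₁ kf.1 + ∑ i, vtx₁ kf.1 i (kf.2 i)) =
      fun kf : Fin K × (Fin M → Fin m) => L (w₁ kf.1) + ∑ i, (fun i b => L (vtx₁ kf.1 i b)) i (kf.2 i) := by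
    funext kf
    exact map_prodFamily L (vtx₁ kf.1) (w₁ kf.1) kf.2
  rw [hcomp] at h2
  exact h2

/-- ★ **THE GEOMETRIC TRANSPORT WITH `(K, M, m)` (PROVED)** (as `transport_geometric_prod`, for unions of product families).
[cite: AboulkerEtAl2019, pp. 5–6 (grid-minor clique face)] [cite: FioriniEtAl2015, Lemma 9] -/
theorem transport_geometric_union :
    ∃ c : ℝ, 0 < c ∧ ∃ t₀ : ℕ, ∀ (n r g : ℕ), 1 ≤ r → (r + 1) * (2 * r + 1) ≤ n → ∀ (hg : 2 * g ≤ r), t₀ ≤ g →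
      ∀ {K M m : ℕ}, 1 ≤ K → 1 ≤ m → ∀ (vtx : Fin K → Fin M → Fin m → (Fin (2 * n) × Fin (2 * n)) → ℝ)
        (w : Fin K → (Fin (2 * n) × Fin (2 * n)) → ℝ) (s : ℕ),
        HasEFOfSize (newt (nestFreeMatchingPoly n ℝ≥0) +
          convexHull ℝ (Set.range fun kf : Fin K × (Fin M → Fin m) => w kf.1 + ∑ i, vtx kf.1 i (kf.2 i))) s →
          ∃ h : ℕ, c * g ≤ h ∧ ∃ (vtx' : Fin K → Fin M → Fin m → (Fin h × Fin h → ℝ)) (w' : Fin K → (Fin h × Fin h → ℝ)),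
            HasEFOfSize (corPolytopeGraph (⊤ : SimpleGraph (Fin h)) +
              convexHull ℝ (Set.range fun kf : Fin K × (Fin M → Fin m) => w' kf.1 + ∑ i, vtx' kf.1 i (kf.2 i))) s := by
  classical
  obtain ⟨c, hc, t₀, hface⟩ := AboulkerEtAl2019_gridCorCliqueFace
  refine ⟨c, hc, t₀, fun n r g hr hn hg ht K M m hK hm vtx w s hEF' => ?_⟩
  obtain ⟨Z, f, hA1⟩ := queueGridZeroOnePoints_holds r n hr hn
  let φ : (Fin (2 * n) × Fin (2 * n)) → ℝ := fun e => if e ∈ Z then (-1 : ℝ) else 0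
  have hφ : ∀ x : (Fin (2 * n) × Fin (2 * n)) → ℝ, φ ⬝ᵥ x = -∑ e ∈ Z, x e := by
    intro x
    simp only [dotProduct, φ, ite_mul, neg_one_mul, zero_mul]
    rw [Finset.sum_ite_mem, Finset.univ_inter, Finset.sum_neg_distrib]
  have hP : ∀ x ∈ newt (nestFreeMatchingPoly n ℝ≥0), φ ⬝ᵥ x ≤ 0 := fun x hx => by
    rw [hφ]; exact neg_nonpos.2 (Finset.sum_nonneg fun e _ => newt_nonneg _ x hx e)
  let Lf : ((Fin (2 * n) × Fin (2 * n)) → ℝ) →ₗ[ℝ] ((QGV r × QGV r) × Bool × Bool → ℝ) :=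
    LinearMap.funLeft ℝ ℝ f
  obtain ⟨vtx₁, w₁, h₁⟩ := transport_step_union hK hm vtx w hEF' φ 0 hP Lf
  have hF : Lf '' (newt (nestFreeMatchingPoly n ℝ≥0) ∩ {x | φ ⬝ᵥ x = 0}) = queueGridPP r := by
    rw [newt_inter_zeroSet_eq, LinearMap.image_convexHull]
    unfold queueGridPP
    congr 1
  rw [hF] at h₁
  have h₂ := hasEFOfSize_image_add h₁ (corMap r g hg)
  rw [corMap_image_queueGridPP, LinearMap.image_convexHull, ← Set.range_comp,
    ← Summit.ValiantsHypothesis.ValiantsHypothesis.Theorems.FifoMatching.QueueGridFace.corPolytopeGraph_eq] at h₂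
  have hcomp : (⇑(corMap r g hg) ∘ fun kf : Fin K × (Fin M → Fin m) => w₁ kf.1 + ∑ i, vtx₁ kf.1 i (kf.2 i)) =
      fun kf : Fin K × (Fin M → Fin m) =>
        corMap r g hg (w₁ kf.1) + ∑ i, (fun i b => corMap r g hg (vtx₁ kf.1 i b)) i (kf.2 i) := by
    funext kf
    exact map_prodFamily (corMap r g hg) (vtx₁ kf.1) (w₁ kf.1) kf.2
  rw [hcomp] at h₂
  obtain ⟨h, hch, k, cv, δ, π, hvalid, hπ⟩ := hface g ht
  obtain ⟨vtx₃, w₃, h₃⟩ := transport_step_union hK hm (fun k i b => corMap r g hg (vtx₁ k i b))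
    (fun k => corMap r g hg (w₁ k)) h₂ (∑ i, cv i) (∑ i, δ i) (sum_dotProduct_le_sum_of_valid _ cv δ hvalid) π
  rw [← inter_eqs_eq_inter_sum_of_valid _ cv δ hvalid, hπ] at h₃
  exact ⟨h, hch, vtx₃, w₃, h₃⟩

/-! ## §3 The law read on `NN_n` -/

/-- ★★ **THE FEW-SUMMANDS LAW FOR UNIONS READ ON `NN_n` (explicit form, PROVED).** [cite: KaibelWeltge2014, Thm. 1] [cite: FioriniEtAl2015, Thm. 7] -/
theorem nn_union_fewSummands :
    ∃ c : ℝ, 0 < c ∧ ∃ t₀ : ℕ, ∀ (n r g : ℕ), 1 ≤ r → (r + 1) * (2 * r + 1) ≤ n → 2 * g ≤ r → t₀ ≤ g →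
      ∀ {K M m : ℕ}, 1 ≤ K → 1 ≤ m → ∀ (vtx : Fin K → Fin M → Fin m → (Fin (2 * n) × Fin (2 * n)) → ℝ)
        (w : Fin K → (Fin (2 * n) × Fin (2 * n)) → ℝ) (s : ℕ),
        HasEFOfSize (newtonPolytope (MvPolynomial.map NNReal.toRealHom (nestFreeMatchingPoly n ℝ≥0)) +
          convexHull ℝ (Set.range fun kf : Fin K × (Fin M → Fin m) => w kf.1 + ∑ i, vtx kf.1 i (kf.2 i))) s →
          ∃ h : ℕ, c * g ≤ h ∧ ∀ (C t : ℕ), 1 ≤ t → (2 * (Nat.log 2 h + C) ^ C + 4) * t ≤ h →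
            2 * K * 8 ^ ((Nat.log 2 h + C) ^ C) ≤ 9 ^ ((Nat.log 2 h + C) ^ C) →
            (K * (M * (m * m))) * Nat.choose (h - t - 1) (t - 1) < Nat.choose (h - 1) (t - 1) →
              2 ^ ((Nat.log 2 h + C) ^ C) < s := by
  obtain ⟨c, hc, t₀, H⟩ := transport_geometric_union
  refine ⟨c, hc, t₀, fun n r g hr hn hg ht K M m hK hm vtx w s hEF => ?_⟩
  have hEF' : HasEFOfSize (newt (nestFreeMatchingPoly n ℝ≥0) +
      convexHull ℝ (Set.range fun kf : Fin K × (Fin M → Fin m) => w kf.1 + ∑ i, vtx kf.1 i (kf.2 i))) s := by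
    rw [newt_eq_newtonPolytope]; exact hEF
  obtain ⟨h, hch, vtx', w', hR⟩ := H n r g hr hn hg ht hK hm vtx w s hEF'
  refine ⟨h, hch, fun C t ht1 hht hKL hcount => ?_⟩
  exact union_summands_decided C h t K M m vtx' w' s ht1 hK hm hKL hht hcount hR

end Summands

end Summit.ValiantsHypothesis.ValiantsHypothesis.Theorems.FifoMatching

end
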